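import Literature.Analysis.PDE.SemilinearHeatBootstrap
import Literature.Analysis.Calculus.JetEvolutionSmoothness
import Literature.Analysis.Calculus.EvolutionDerivBounds
import Literature.Analysis.Calculus.SmoothExtensionToClosure
import Literature.Analysis.Calculus.DeltaSymbolClasses
import HarnessLib

/-!
# Mild solutions of semilinear heat systems are classical and jointly smooth up to `t = 0`

Analysis/PDE support file (everything proved; no definitions, no named facts). Third step of the
local well-posedness theory of `∂ₜu = Δu + f(x, u, ∂u)` (Taylor, *PDE III*, Ch. 15, §1; Lunardi,
*Analytic semigroups …*, Prop. 4.1.2 and §7.1): a mild solution with smooth bounded data, known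
to be smooth in space with all derivatives bounded and jointly continuous
(`SemilinearHeatBootstrap.lean`), solves the equation classically — every spatial derivative
`Dᵏu(·, x)` is differentiable in time with derivative `Dᵏ(Δu + f(·, u, ∂u))(x)` (right
derivative from the mild formula, `hasDerivWithinAt_duhamel_Ici`; the right derivative is
continuous as a smooth *jet expression* of `u`, `Calculus/JetEvolutionSmoothness.lean`, hence is
the derivative) — and is therefore jointly `C^∞` on `(0, T) × E` (the jet calculus
`contDiff_uncurry_of_jet_evolution`, after the time reparametrisation `t = T eˢ/(1 + eˢ)` of
`(0, T)` by `ℝ`).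

* `continuousOn_prod_of_isJetExprOf` — jet expressions are jointly continuous where the jets are;
* `rhsSlice_heatJet` — the right-hand side `Δu + f(x, u, ∂u)` as a smooth function of the 2-jet;
* `hasDerivAt_iteratedFDeriv_slice` — `∂ₜDᵏu = Dᵏ(Δu + f(·, u, ∂u))` pointwise on `(0, T)`;
* `hasDerivAt_slice` — the equation `∂ₜu = Δu + f(x, u, ∂u)` pointwise on `(0, T)`;
* `contDiffOn_uncurry_Ioo` — `u` is `C^∞` on `(0, T) × E`;
* `contDiffOn_uncurry_Ico` — `u` is `C^∞` on `[0, T) × E` when moreover `u(0) = u₀` and `V` is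
  finite-dimensional (bounds of all space-time derivatives through the equation,
  `Calculus/EvolutionDerivBounds.lean`, and the smooth extension to the closure,
  `Calculus/SmoothExtensionToClosure.lean`).

## References

* M. E. Taylor, *Partial Differential Equations III. Nonlinear Equations*, 2nd ed., Springer
  (2011), Ch. 15, §1. [TaylorPDEIII2011]
* A. Lunardi, *Analytic Semigroups and Optimal Regularity in Parabolic Problems*, Birkhäuser
  (1995), Prop. 4.1.2, §7.1. [folklore]
* S. Alinhac, *Hyperbolic Partial Differential Equations* (2009), proof of Thm. 7.11, Step 2 (d)
  (time derivatives through the equation). [AlinhacHPDE2009]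
-/

noncomputable section

open MeasureTheory Set Function Filter Metric Real
open _root_.Topology
open scoped ENNReal NNReal ContDiff Laplacian

namespace Literature.Analysis.PDE

namespace SemilinearHeat

open Literature.Analysis.UnboundedOperators Literature.Analysis.UnboundedOperators.HeatHolder
open Literature.Analysis.FluidPDE
open Literature.Analysis.Calculus

-- nested operator types
set_option maxSynthPendingDepth 3

/-! ### Jet expressions on a time interval -/

section JetContinuity

variable {X W U : Type} [NormedAddCommGroup X] [NormedSpace ℝ X] [NormedAddCommGroup W]
  [NormedSpace ℝ W] [NormedAddCommGroup U] [NormedSpace ℝ U]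

/-- **Jet expressions are jointly continuous where the jets are**: if
`F(t, x) = Φ(t, x, jet m (b t) x)` with `Φ` smooth and every `(t, x) ↦ Dᵏ(b t)(x)` is continuous on
`S × X`, then `F` is continuous on `S × X`. [folklore] -/
theorem continuousOn_prod_of_isJetExprOf {b : ℝ → X → W} {m : ℕ} {F : ℝ × X → U}
    (hF : IsJetExprOf b m F) {S : Set ℝ}
    (hb : ∀ k : ℕ, ContinuousOn (fun p : ℝ × X => iteratedFDeriv ℝ k (b p.1) p.2) (S ×ˢ univ)) :
    ContinuousOn F (S ×ˢ univ) := by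
  obtain ⟨Φ, hΦ, hFΦ⟩ := hF
  have h : F = fun p : ℝ × X => Φ (p.1, p.2, jet m (b p.1) p.2) := funext fun p => hFΦ p.1 p.2
  rw [h]
  have hj : ContinuousOn (fun p : ℝ × X => jet m (b p.1) p.2) (S ×ˢ univ) :=
    continuousOn_pi.2 fun k => hb k
  exact hΦ.continuous.comp_continuousOn (continuousOn_fst.prodMk (continuousOn_snd.prodMk hj))

/-- Time slices of jet expressions are continuous on `S`. [folklore] -/
theorem continuousOn_slice_of_isJetExprOf {b : ℝ → X → W} {m : ℕ} {F : ℝ × X → U}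
    (hF : IsJetExprOf b m F) {S : Set ℝ}
    (hb : ∀ k : ℕ, ContinuousOn (fun p : ℝ × X => iteratedFDeriv ℝ k (b p.1) p.2) (S ×ˢ univ))
    (x : X) : ContinuousOn (fun t => F (t, x)) S :=
  (continuousOn_prod_of_isJetExprOf hF hb).comp (continuous_id.prodMk continuous_const).continuousOn
    fun _ ht => ⟨ht, mem_univ _⟩

/-- The jet of a smooth slice is smooth in `x`. [folklore] -/
theorem contDiff_jet {g : X → W} (hg : ContDiff ℝ ∞ g) (m : ℕ) :
    ContDiff ℝ ∞ (jet m g) :=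
  contDiff_pi.2 fun k => contDiff_infty.2 fun n =>
    hg.iteratedFDeriv_right (mod_cast (le_top : ((n + (k : ℕ) : ℕ) : ℕ∞) ≤ ⊤))

/-- `rhsSlice N b t` is smooth in `x` for smooth `N` and smooth slices. [folklore] -/
theorem contDiff_rhsSlice {b : ℝ → X → W} {m₀ : ℕ} {N : ℝ × X × Jet X W m₀ → W}
    (hN : ContDiff ℝ ∞ N) (hb : ∀ t, ContDiff ℝ ∞ (b t)) (t : ℝ) :
    ContDiff ℝ ∞ (rhsSlice N b t) :=
  hN.comp (contDiff_const.prodMk (contDiff_id.prodMk (contDiff_jet (hb t) m₀)))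

end JetContinuity

/-! ### The right-hand side as a function of the 2-jet -/

section HeatJet

variable {E : Type} [NormedAddCommGroup E] [InnerProductSpace ℝ E] [FiniteDimensional ℝ E]
variable {V : Type} [NormedAddCommGroup V] [NormedSpace ℝ V]

/-- **The semilinear heat operator on jets.** For `f : E × V × (E →L V) → V` and the standard
orthonormal basis `b` of `E`, the map
`N(t, y, j) = Σᵢ j₂(bᵢ, bᵢ) + f(y, j₀, j₁)` (with the curry isomorphisms `j₀ ↦ j₀()`,
`j₁ ↦ (v ↦ j₁(v))`) is smooth when `f` is, and its slice along a `C²` function is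
`Δg + f(·, g, ∂g)`. [folklore] -/
theorem rhsSlice_heatJet {f : E × V × (E →L[ℝ] V) → V} (u : ℝ → E → V) (t : ℝ) (y : E) :
    rhsSlice (fun q : ℝ × E × Jet E V 2 =>
      (∑ i, (q.2.2 2) ![stdOrthonormalBasis ℝ E i, stdOrthonormalBasis ℝ E i]) +
        f (q.2.1, continuousMultilinearCurryFin0 ℝ E V (q.2.2 0),
          continuousMultilinearCurryFin1 ℝ E V (q.2.2 1))) u t y =
      (Δ (u t)) y + f (y, u t y, fderiv ℝ (u t) y) := by
  have h0 : continuousMultilinearCurryFin0 ℝ E V (jet 2 (u t) y 0) = u t y := by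
    change continuousMultilinearCurryFin0 ℝ E V (iteratedFDeriv ℝ 0 (u t) y) = u t y
    rw [continuousMultilinearCurryFin0_apply, iteratedFDeriv_zero_apply]
  have h1 : continuousMultilinearCurryFin1 ℝ E V (jet 2 (u t) y 1) = fderiv ℝ (u t) y := by
    change continuousMultilinearCurryFin1 ℝ E V (iteratedFDeriv ℝ 1 (u t) y) = fderiv ℝ (u t) y
    ext v
    rw [continuousMultilinearCurryFin1_apply, iteratedFDeriv_one_apply]
    simp
  rw [rhsSlice_apply]
  dsimp only
  rw [h0, h1, InnerProductSpace.laplacian_eq_iteratedFDeriv_orthonormalBasis (u t) (stdOrthonormalBasis ℝ E)]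
  rfl

/-- Smoothness of the semilinear heat operator on jets. [folklore] -/
theorem contDiff_heatJet {f : E × V × (E →L[ℝ] V) → V} (hf : ContDiff ℝ ∞ f) :
    ContDiff ℝ ∞ (fun q : ℝ × E × Jet E V 2 =>
      (∑ i, (q.2.2 2) ![stdOrthonormalBasis ℝ E i, stdOrthonormalBasis ℝ E i]) +
        f (q.2.1, continuousMultilinearCurryFin0 ℝ E V (q.2.2 0),
          continuousMultilinearCurryFin1 ℝ E V (q.2.2 1))) := by
  have hj : ∀ k : Fin 3, ContDiff ℝ ∞ (fun q : ℝ × E × Jet E V 2 => q.2.2 k) := fun k =>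
    (ContinuousLinearMap.proj (R := ℝ)
      (φ := fun k : Fin 3 => ContinuousMultilinearMap ℝ (fun _ : Fin k => E) V) k).contDiff.comp
      (contDiff_snd.comp contDiff_snd)
  refine (ContDiff.sum fun i _ => ?_).add ?_
  · exact (ContinuousMultilinearMap.apply ℝ (fun _ : Fin 2 => E) V
      ![stdOrthonormalBasis ℝ E i, stdOrthonormalBasis ℝ E i]).contDiff.comp (hj 2)
  · exact hf.comp ((contDiff_fst.comp contDiff_snd).prodMk
      (((continuousMultilinearCurryFin0 ℝ E V).toContinuousLinearEquiv.contDiff.comp (hj 0)).prodMk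
        ((continuousMultilinearCurryFin1 ℝ E V).toContinuousLinearEquiv.contDiff.comp (hj 1))))

omit [FiniteDimensional ℝ E] in
/-- The data part of the semilinear heat operator on jets, `N₁(t, y, j) = f(y, j₀, j₁)`: its slice
along a function is `f(·, g, ∂g)`. [folklore] -/
theorem rhsSlice_dataJet {f : E × V × (E →L[ℝ] V) → V} (u : ℝ → E → V) (t : ℝ) :
    rhsSlice (fun q : ℝ × E × Jet E V 2 =>
        f (q.2.1, continuousMultilinearCurryFin0 ℝ E V (q.2.2 0),
          continuousMultilinearCurryFin1 ℝ E V (q.2.2 1))) u t =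
      fun y => f (y, u t y, fderiv ℝ (u t) y) := by
  funext y
  have h0 : continuousMultilinearCurryFin0 ℝ E V (jet 2 (u t) y 0) = u t y := by
    change continuousMultilinearCurryFin0 ℝ E V (iteratedFDeriv ℝ 0 (u t) y) = u t y
    rw [continuousMultilinearCurryFin0_apply, iteratedFDeriv_zero_apply]
  have h1 : continuousMultilinearCurryFin1 ℝ E V (jet 2 (u t) y 1) = fderiv ℝ (u t) y := by
    change continuousMultilinearCurryFin1 ℝ E V (iteratedFDeriv ℝ 1 (u t) y) = fderiv ℝ (u t) y
    ext v
    rw [continuousMultilinearCurryFin1_apply, iteratedFDeriv_one_apply]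
    simp
  rw [rhsSlice_apply]
  dsimp only
  rw [h0, h1]

omit [FiniteDimensional ℝ E] in
/-- Smoothness of the data operator on jets. [folklore] -/
theorem contDiff_dataJet {f : E × V × (E →L[ℝ] V) → V} (hf : ContDiff ℝ ∞ f) :
    ContDiff ℝ ∞ (fun q : ℝ × E × Jet E V 2 =>
      f (q.2.1, continuousMultilinearCurryFin0 ℝ E V (q.2.2 0),
        continuousMultilinearCurryFin1 ℝ E V (q.2.2 1))) := by
  have hj : ∀ k : Fin 3, ContDiff ℝ ∞ (fun q : ℝ × E × Jet E V 2 => q.2.2 k) := fun k =>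
    (ContinuousLinearMap.proj (R := ℝ)
      (φ := fun k : Fin 3 => ContinuousMultilinearMap ℝ (fun _ : Fin k => E) V) k).contDiff.comp
      (contDiff_snd.comp contDiff_snd)
  exact hf.comp ((contDiff_fst.comp contDiff_snd).prodMk
    (((continuousMultilinearCurryFin0 ℝ E V).toContinuousLinearEquiv.contDiff.comp (hj 0)).prodMk
      ((continuousMultilinearCurryFin1 ℝ E V).toContinuousLinearEquiv.contDiff.comp (hj 1))))

end HeatJet

/-! ### The mild solution is a classical solution -/

section Classical

variable {E : Type} [NormedAddCommGroup E] [InnerProductSpace ℝ E] [FiniteDimensional ℝ E]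
  [MeasurableSpace E] [BorelSpace E]
variable {V : Type} [NormedAddCommGroup V] [NormedSpace ℝ V] [CompleteSpace V]

set_option maxHeartbeats 800000 in
/-- **The right time derivative of the spatial derivatives of a mild solution.** Setting: `u` has
smooth slices whose spatial derivatives are jointly continuous on `[0, T] × E`, `T ≤ 1`, and on
`(0, T]` it is given by the mild formula `u(t) = e^{tΔ}u₀ + ∫₀ᵗ e^{(t−s)Δ}g̃(s) ds` with `u₀`
and all slices `g̃(s)` smooth with bounded derivatives (one constant per order), `g̃` jointly
measurable and equal to `f(·, u(t), ∂u(t))` for `t ∈ (0, T]`. Then for `t ∈ (0, T)`,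
`τ ↦ Dᵏu(τ)(x)` has the right derivative `Dᵏ(Δu(t) + f(·, u(t), ∂u(t)))(x)` at `t`: the right
derivative of the mild formula for `Dᵏu` (`Dᵏ` falls on the data; the free part by the heat
equation, the Duhamel part by `hasDerivWithinAt_duhamel_Ici`, the data `Dᵏg̃(·, x)` being
right-continuous as a jet expression of `u`) is `e^{tΔ}ΔDᵏu₀ + ∫₀ᵗ e^{(t−s)Δ}ΔDᵏg̃ + Dᵏg̃(t)
= ΔDᵏu(t) + Dᵏg̃(t) = Dᵏ(Δu(t) + g̃(t))`. [cite: TaylorPDEIII2011, Ch. 15, §1] -/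
theorem hasDerivWithinAt_iteratedFDeriv_slice
    {f : E × V × (E →L[ℝ] V) → V} (hf : ContDiff ℝ ∞ f)
    {u₀ : E → V} (hu₀ : ∀ n, ∃ A, IsCkBounded n A u₀)
    {gt : ℝ → E → V} (hgtm : StronglyMeasurable (uncurry gt))
    (hgt : ∀ n, ∃ G, ∀ s, IsCkBounded n G (gt s))
    {u : ℝ → E → V} {T : ℝ} (hT1 : T ≤ 1) (hsm : ∀ t, ContDiff ℝ ∞ (u t))
    (hcont : ∀ k, ContinuousOn (fun p : ℝ × E => iteratedFDeriv ℝ k (u p.1) p.2) (Icc 0 T ×ˢ univ))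
    (hrep : ∀ t ∈ Ioc 0 T, u t = heatExtension u₀ t +
      fun x => ∫ s in Ioo 0 t, heatExtension (gt s) (t - s) x)
    (hgt_eq : ∀ t ∈ Ioc 0 T, gt t = fun y => f (y, u t y, fderiv ℝ (u t) y))
    (k : ℕ) {t : ℝ} (ht : t ∈ Ioo 0 T) (x : E) :
    HasDerivWithinAt (fun τ => iteratedFDeriv ℝ k (u τ) x)
      (iteratedFDeriv ℝ k (fun y => (Δ (u t)) y + f (y, u t y, fderiv ℝ (u t) y)) x) (Ici t) t := by
  obtain ⟨A, hA⟩ := hu₀ (k + 2)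
  obtain ⟨G, hG⟩ := hgt (k + 2)
  have htI : t ∈ Ioc 0 T := ⟨ht.1, ht.2.le⟩
  -- the data `Dᵏg̃`: a measurable family of `C²`-bounded slices
  have hmk : StronglyMeasurable (uncurry fun s y => iteratedFDeriv ℝ k (gt s) y) :=
    stronglyMeasurable_iteratedFDeriv_family hgtm (fun s => (hG s).contDiff) k (by omega)
  have hk2 : ∀ s, IsCkBounded 2 G (iteratedFDeriv ℝ k (gt s)) := fun s => isCkBounded_iteratedFDeriv (hG s)
  have hA2 : IsCkBounded 2 A (iteratedFDeriv ℝ k u₀) := isCkBounded_iteratedFDeriv hA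
  have hA2' : ∀ z, ‖fderiv ℝ (fderiv ℝ (iteratedFDeriv ℝ k u₀)) z‖ ≤ A := fun z => by
    rw [norm_fderiv_fderiv_eq]; exact hA2.norm_le 2 le_rfl z
  -- the representation of `Dᵏu` on `(0, T]`
  have hrepF : ∀ τ ∈ Ioc 0 T, iteratedFDeriv ℝ k (u τ) = heatExtension (iteratedFDeriv ℝ k u₀) τ +
      fun x => ∫ s in Ioo 0 τ, heatExtension (iteratedFDeriv ℝ k (gt s)) (τ - s) x := fun τ hτ =>
    iteratedFDeriv_slice_eq (k := k) hT1 (hA.of_le (by omega)) hgtm (fun s => (hG s).of_le (by omega)) hrep hτ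
  have hrepk : ∀ τ ∈ Ioc 0 T, iteratedFDeriv ℝ k (u τ) x = heatExtension (iteratedFDeriv ℝ k u₀) τ x +
      ∫ s in Ioo 0 τ, heatExtension (iteratedFDeriv ℝ k (gt s)) (τ - s) x := fun τ hτ =>
    congrFun (hrepF τ hτ) x
  -- neighbourhoods within `Ici t`
  have hmemIcc : Icc 0 T ∈ 𝓝[Ici t] t :=
    mem_nhdsWithin.2 ⟨Iio T, isOpen_Iio, ht.2, fun s hs => ⟨ht.1.le.trans hs.2, hs.1.le⟩⟩
  have hmemIoc : ∀ᶠ s in 𝓝[Ici t] t, s ∈ Ioc 0 T := by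
    have h : Ioc 0 T ∈ 𝓝[Ici t] t :=
      mem_nhdsWithin.2 ⟨Iio T, isOpen_Iio, ht.2, fun s hs => ⟨ht.1.trans_le hs.2, hs.1.le⟩⟩
    exact h
  -- right-continuity of `s ↦ Dᵏg̃(s)(x)` at `t`: a jet expression of `u` on `(0, T]`
  have hrc : ContinuousWithinAt (fun s => iteratedFDeriv ℝ k (gt s) x) (Ici t) t := by
    set N₁ : ℝ × E × Jet E V 2 → V := fun q =>
      f (q.2.1, continuousMultilinearCurryFin0 ℝ E V (q.2.2 0), continuousMultilinearCurryFin1 ℝ E V (q.2.2 1))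
      with hN₁
    have hJE := isJetExprOf_iteratedFDeriv_rhsSlice (b := u) (N := N₁) hsm (contDiff_dataJet hf) k
    have hcs : ContinuousOn (fun s => iteratedFDeriv ℝ k (rhsSlice N₁ u s) x) (Icc 0 T) :=
      continuousOn_slice_of_isJetExprOf hJE hcont x
    have hdata : ∀ s, rhsSlice N₁ u s = fun y => f (y, u s y, fderiv ℝ (u s) y) := fun s =>
      rhsSlice_dataJet u s
    have hcw : ContinuousWithinAt (fun s => iteratedFDeriv ℝ k (rhsSlice N₁ u s) x) (Ici t) t :=
      (hcs t ⟨ht.1.le, ht.2.le⟩).mono_of_mem_nhdsWithin hmemIcc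
    refine hcw.congr_of_eventuallyEq ?_ ?_
    · filter_upwards [hmemIoc] with s hs
      rw [hgt_eq s hs, hdata s]
    · rw [hgt_eq t htI, hdata t]
  -- the right derivative of the representation
  have hfreeD : HasDerivWithinAt (fun τ => heatExtension (iteratedFDeriv ℝ k u₀) τ x)
      (heatExtension (Δ (iteratedFDeriv ℝ k u₀)) t x) (Ici t) t :=
    (hasDerivAt_heatExtension_time_of_bounded hA2.contDiff hA2.norm_apply_le hA2.norm_fderiv_le
      hA2' ht.1 x).hasDerivWithinAt
  have hJD := hasDerivWithinAt_duhamel_Ici hmk hk2 ht.1.le hrc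
  have hφ : HasDerivWithinAt (fun τ => iteratedFDeriv ℝ k (u τ) x)
      (heatExtension (Δ (iteratedFDeriv ℝ k u₀)) t x +
        ((∫ s in Ioo 0 t, heatExtension (Δ (iteratedFDeriv ℝ k (gt s))) (t - s) x) +
          iteratedFDeriv ℝ k (gt t) x)) (Ici t) t := by
    refine (hfreeD.add hJD).congr_of_eventuallyEq ?_ (hrepk t htI)
    filter_upwards [hmemIoc] with τ hτ
    exact hrepk τ hτ
  refine hφ.congr_deriv ?_
  -- identification of the derivative with `Dᵏ(Δu(t) + g(t))(x)`
  have hΔc : ContDiff ℝ ∞ (Δ (u t)) := by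
    rw [InnerProductSpace.laplacian_eq_iteratedFDeriv_orthonormalBasis (u t) (stdOrthonormalBasis ℝ E)]
    exact ContDiff.sum fun i _ =>
      (ContinuousMultilinearMap.apply ℝ (fun _ : Fin 2 => E) V
        ![stdOrthonormalBasis ℝ E i, stdOrthonormalBasis ℝ E i]).contDiff.comp
        (contDiff_infty.2 fun n => (hsm t).iteratedFDeriv_right (natCast_le_infty (n + 2)))
  have hdc : ContDiff ℝ ∞ (fun y => f (y, u t y, fderiv ℝ (u t) y)) :=
    hf.comp (contDiff_id.prodMk ((hsm t).prodMk (contDiff_infty.2 fun n =>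
      (hsm t).fderiv_right (mod_cast (le_top : ((n + 1 : ℕ) : ℕ∞) ≤ ⊤)))))
  have hadd : iteratedFDeriv ℝ k (fun y => (Δ (u t)) y + f (y, u t y, fderiv ℝ (u t) y)) x =
      iteratedFDeriv ℝ k (Δ (u t)) x + iteratedFDeriv ℝ k (fun y => f (y, u t y, fderiv ℝ (u t) y)) x := by
    have h := iteratedFDeriv_add_apply (i := k) (hΔc.contDiffAt.of_le (mod_cast (le_top : ((k : ℕ) : ℕ∞) ≤ ⊤)))
      (hdc.contDiffAt.of_le (mod_cast (le_top : ((k : ℕ) : ℕ∞) ≤ ⊤))) (x := x)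
    exact h
  have hcomm : iteratedFDeriv ℝ k (Δ (u t)) x = (Δ (iteratedFDeriv ℝ k (u t))) x :=
    iteratedFDeriv_laplacian_apply ((hsm t).of_le (natCast_le_infty (k + 2))) x
  -- the Laplacian of the representation
  have hF₁ : ContDiff ℝ ∞ (heatExtension (iteratedFDeriv ℝ k u₀) t) :=
    contDiff_heatExtension_of_bound hA2.contDiff.continuous hA2.norm_apply_le ht.1
  have hF₂ : ContDiff ℝ 2 (fun x => ∫ s in Ioo 0 t, heatExtension (iteratedFDeriv ℝ k (gt s)) (t - s) x) :=
    contDiff_duhamel_of_isCkBounded hmk hk2 ht.1 (htI.2.trans hT1)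
  have hΔrep : (Δ (iteratedFDeriv ℝ k (u t))) x =
      heatExtension (Δ (iteratedFDeriv ℝ k u₀)) t x +
        ∫ s in Ioo 0 t, heatExtension (Δ (iteratedFDeriv ℝ k (gt s))) (t - s) x := by
    rw [hrepF t htI]
    rw [(hF₁.contDiffAt.of_le (natCast_le_infty 2)).laplacian_add hF₂.contDiffAt,
      laplacian_heatExtension_of_bounded hA2.contDiff hA2.norm_apply_le hA2.norm_fderiv_le hA2' ht.1 x,
      laplacian_duhamel_apply hmk hk2 t x]
  rw [hadd, hcomm, hΔrep, hgt_eq t htI]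
  abel

/-- **The mild solution is a classical solution, to all orders in space**: for `t ∈ (0, T)`,
`τ ↦ Dᵏu(τ)(x)` is differentiable at `t` with derivative `Dᵏ(Δu(t) + f(·, u(t), ∂u(t)))(x)`
(the right derivative of the previous theorem is continuous in `t` — a jet expression of `u`
through `rhsSlice_heatJet` — so it is the derivative, `hasDerivAt_of_hasDerivWithinAt_Ici`).
[cite: TaylorPDEIII2011, Ch. 15, §1] -/
theorem hasDerivAt_iteratedFDeriv_slice
    {f : E × V × (E →L[ℝ] V) → V} (hf : ContDiff ℝ ∞ f)
    {u₀ : E → V} (hu₀ : ∀ n, ∃ A, IsCkBounded n A u₀)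
    {gt : ℝ → E → V} (hgtm : StronglyMeasurable (uncurry gt))
    (hgt : ∀ n, ∃ G, ∀ s, IsCkBounded n G (gt s))
    {u : ℝ → E → V} {T : ℝ} (hT1 : T ≤ 1) (hsm : ∀ t, ContDiff ℝ ∞ (u t))
    (hcont : ∀ k, ContinuousOn (fun p : ℝ × E => iteratedFDeriv ℝ k (u p.1) p.2) (Icc 0 T ×ˢ univ))
    (hrep : ∀ t ∈ Ioc 0 T, u t = heatExtension u₀ t +
      fun x => ∫ s in Ioo 0 t, heatExtension (gt s) (t - s) x)
    (hgt_eq : ∀ t ∈ Ioc 0 T, gt t = fun y => f (y, u t y, fderiv ℝ (u t) y))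
    (k : ℕ) {t : ℝ} (ht : t ∈ Ioo 0 T) (x : E) :
    HasDerivAt (fun τ => iteratedFDeriv ℝ k (u τ) x)
      (iteratedFDeriv ℝ k (fun y => (Δ (u t)) y + f (y, u t y, fderiv ℝ (u t) y)) x) t := by
  -- the right-hand side as a jet expression: continuity of `τ ↦ Dᵏ(Δu(τ) + g(τ))(x)` on `[0, T]`
  set N : ℝ × E × Jet E V 2 → V := fun q =>
    (∑ i, (q.2.2 2) ![stdOrthonormalBasis ℝ E i, stdOrthonormalBasis ℝ E i]) +
      f (q.2.1, continuousMultilinearCurryFin0 ℝ E V (q.2.2 0), continuousMultilinearCurryFin1 ℝ E V (q.2.2 1))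
    with hN
  have hJE := isJetExprOf_iteratedFDeriv_rhsSlice (b := u) (N := N) hsm (contDiff_heatJet hf) k
  have hcs : ContinuousOn (fun s => iteratedFDeriv ℝ k (rhsSlice N u s) x) (Icc 0 T) :=
    continuousOn_slice_of_isJetExprOf hJE hcont x
  have hrhs : ∀ s, rhsSlice N u s = fun y => (Δ (u s)) y + f (y, u s y, fderiv ℝ (u s) y) := fun s =>
    funext fun y => rhsSlice_heatJet u s y
  have hψ : ContinuousOn (fun s => iteratedFDeriv ℝ k (fun y => (Δ (u s)) y + f (y, u s y, fderiv ℝ (u s) y)) x)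
      (Ioo 0 T) := by
    refine (hcs.mono Ioo_subset_Icc_self).congr fun s _ => ?_
    change _ = iteratedFDeriv ℝ k (rhsSlice N u s) x
    rw [hrhs s]
  have hφ : ContinuousOn (fun s => iteratedFDeriv ℝ k (u s) x) (Ioo 0 T) :=
    ((hcont k).comp (continuous_id.prodMk continuous_const).continuousOn
      fun s hs => ⟨Ioo_subset_Icc_self hs, mem_univ _⟩)
  exact hasDerivAt_of_hasDerivWithinAt_Ici hφ hψ
    (fun s hs => hasDerivWithinAt_iteratedFDeriv_slice hf hu₀ hgtm hgt hT1 hsm hcont hrep hgt_eq k hs x) ht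

/-- **Joint smoothness on `(0, T) × E`.** Under the hypotheses of
`hasDerivAt_iteratedFDeriv_slice`, `u` is `C^∞` on `(0, T) × E`: after the reparametrisation
`t = φ(s) = T eˢ/(1 + eˢ)` of `(0, T)` by `ℝ`, the family `b(s) = u(φ(s))` has smooth slices,
jointly continuous jets, and `∂ₛDᵏb = Dᵏ(φ'(s)(Δb + f(·, b, ∂b)))` for all `k` (chain rule), so
the jet calculus `contDiff_uncurry_of_jet_evolution` (Alinhac 2009, Thm. 7.11, Step 2 (d)) gives
`b ∈ C^∞(ℝ × E)`, and `u(t, x) = b(log(t/(T − t)), x)`. [cite: AlinhacHPDE2009, Thm. 7.11 proof Step 2 (d)] -/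
theorem contDiffOn_uncurry_Ioo
    {f : E × V × (E →L[ℝ] V) → V} (hf : ContDiff ℝ ∞ f)
    {u₀ : E → V} (hu₀ : ∀ n, ∃ A, IsCkBounded n A u₀)
    {gt : ℝ → E → V} (hgtm : StronglyMeasurable (uncurry gt))
    (hgt : ∀ n, ∃ G, ∀ s, IsCkBounded n G (gt s))
    {u : ℝ → E → V} {T : ℝ} (hT : 0 < T) (hT1 : T ≤ 1) (hsm : ∀ t, ContDiff ℝ ∞ (u t))
    (hcont : ∀ k, ContinuousOn (fun p : ℝ × E => iteratedFDeriv ℝ k (u p.1) p.2) (Icc 0 T ×ˢ univ))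
    (hrep : ∀ t ∈ Ioc 0 T, u t = heatExtension u₀ t +
      fun x => ∫ s in Ioo 0 t, heatExtension (gt s) (t - s) x)
    (hgt_eq : ∀ t ∈ Ioc 0 T, gt t = fun y => f (y, u t y, fderiv ℝ (u t) y)) :
    ContDiffOn ℝ ∞ (uncurry u) (Ioo 0 T ×ˢ (univ : Set E)) := by
  -- ### the reparametrisation `φ : ℝ → (0, T)`
  set σ : ℝ → ℝ := fun s => Real.exp s / (1 + Real.exp s) with hσ
  set φ : ℝ → ℝ := fun s => T * σ s with hφ
  have hden : ∀ s, 0 < 1 + Real.exp s := fun s => by positivity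
  have hσpos : ∀ s, 0 < σ s := fun s => div_pos (Real.exp_pos s) (hden s)
  have hσlt : ∀ s, σ s < 1 := fun s => by
    rw [hσ]; dsimp only; rw [div_lt_one (hden s)]; linarith
  have hφmem : ∀ s, φ s ∈ Ioo 0 T := fun s =>
    ⟨mul_pos hT (hσpos s), by nlinarith [hσlt s, hσpos s]⟩
  have hσc : ContDiff ℝ ∞ σ :=
    Real.contDiff_exp.div (contDiff_const.add Real.contDiff_exp) fun s => (hden s).ne'
  have hφc : ContDiff ℝ ∞ φ := contDiff_const.mul hσc
  set dφ : ℝ → ℝ := fun s => fderiv ℝ φ s 1 with hdφ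
  have hφd : ∀ s, HasDerivAt φ (dφ s) s := fun s =>
    ((hφc.differentiable (by simp)) s).hasFDerivAt.hasDerivAt
  have hdφc : ContDiff ℝ ∞ dφ := contDiff_infty.2 fun n =>
    (hφc.fderiv_right (mod_cast (le_top : ((n + 1 : ℕ) : ℕ∞) ≤ ⊤))).clm_apply contDiff_const
  -- ### the reparametrised family and operator
  set b : ℝ → E → V := fun s => u (φ s) with hb
  have hb1 : ∀ s, ContDiff ℝ ∞ (b s) := fun s => hsm _
  have hb2 : ∀ k, Continuous fun p : ℝ × E => iteratedFDeriv ℝ k (b p.1) p.2 := fun k =>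
    (hcont k).comp_continuous (f := fun p : ℝ × E => (φ p.1, p.2))
      ((hφc.continuous.comp continuous_fst).prodMk continuous_snd)
      fun p => ⟨Ioo_subset_Icc_self (hφmem p.1), mem_univ _⟩
  set N : ℝ × E × Jet E V 2 → V := fun q =>
    (∑ i, (q.2.2 2) ![stdOrthonormalBasis ℝ E i, stdOrthonormalBasis ℝ E i]) +
      f (q.2.1, continuousMultilinearCurryFin0 ℝ E V (q.2.2 0), continuousMultilinearCurryFin1 ℝ E V (q.2.2 1))
    with hN
  have hNc : ContDiff ℝ ∞ N := contDiff_heatJet hf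
  set Nt : ℝ × E × Jet E V 2 → V := fun q => dφ q.1 • N q with hNt
  have hNtc : ContDiff ℝ ∞ Nt := (hdφc.comp contDiff_fst).smul hNc
  have hrhs : ∀ t, rhsSlice N u t = fun y => (Δ (u t)) y + f (y, u t y, fderiv ℝ (u t) y) := fun t =>
    funext fun y => rhsSlice_heatJet u t y
  have hb3 : ∀ (k : ℕ) (s : ℝ) (x : E), HasDerivAt (fun τ => iteratedFDeriv ℝ k (b τ) x)
      (iteratedFDeriv ℝ k (rhsSlice Nt b s) x) s := by
    intro k s x
    have h1 := hasDerivAt_iteratedFDeriv_slice hf hu₀ hgtm hgt hT1 hsm hcont hrep hgt_eq k (hφmem s) x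
    have h2 := h1.scomp s (hφd s)
    have hrs : rhsSlice Nt b s = dφ s • rhsSlice N u (φ s) := by
      funext y; rfl
    have hk : iteratedFDeriv ℝ k (rhsSlice Nt b s) x = dφ s • iteratedFDeriv ℝ k (rhsSlice N u (φ s)) x := by
      rw [hrs]
      exact iteratedFDeriv_const_smul_apply
        ((contDiff_rhsSlice hNc hsm (φ s)).of_le (mod_cast (le_top : ((k : ℕ) : ℕ∞) ≤ ⊤))).contDiffAt
    rw [hk, hrhs (φ s)]
    exact h2
  have hsmooth : ContDiff ℝ ∞ (uncurry b) := contDiff_uncurry_of_jet_evolution hNtc hb1 hb2 hb3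
  -- ### back to `u` on `(0, T) × E`
  set ψ : ℝ → ℝ := fun t => Real.log (t / (T - t)) with hψ
  have hψc : ContDiffOn ℝ ∞ ψ (Ioo 0 T) := by
    refine ContDiffOn.log (contDiffOn_id.div (contDiffOn_const.sub contDiffOn_id)
      fun t ht => (sub_pos.2 ht.2).ne') fun t ht => ?_
    exact (div_pos ht.1 (sub_pos.2 ht.2)).ne'
  have hφψ : ∀ t ∈ Ioo (0 : ℝ) T, φ (ψ t) = t := by
    intro t ht
    have hq : 0 < t / (T - t) := div_pos ht.1 (sub_pos.2 ht.2)
    have hTt : T - t ≠ 0 := (sub_pos.2 ht.2).ne'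
    have hT0 : T ≠ 0 := hT.ne'
    rw [hφ, hσ, hψ]
    dsimp only
    rw [Real.exp_log hq, one_add_div hTt, sub_add_cancel, div_div_div_cancel_right₀ hTt,
      mul_div_assoc', mul_div_cancel_left₀ t hT0]
  have hcomp : ContDiffOn ℝ ∞ (fun p : ℝ × E => uncurry b (ψ p.1, p.2)) (Ioo 0 T ×ˢ univ) :=
    hsmooth.comp_contDiffOn ((hψc.comp contDiffOn_fst fun p hp => hp.1).prodMk contDiffOn_snd)
  refine hcomp.congr fun p hp => ?_
  change u p.1 p.2 = u (φ (ψ p.1)) p.2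
  rw [hφψ p.1 hp.1]

/-- **The equation itself**: for `t ∈ (0, T)`, `τ ↦ u(τ, x)` has derivative
`Δu(t)(x) + f(x, u(t, x), ∂u(t)(x))` at `t` (order zero of the previous theorem, read through
the isomorphism `V ≅ E[×0]→L V`). [cite: TaylorPDEIII2011, Ch. 15, §1] -/
theorem hasDerivAt_slice
    {f : E × V × (E →L[ℝ] V) → V} (hf : ContDiff ℝ ∞ f)
    {u₀ : E → V} (hu₀ : ∀ n, ∃ A, IsCkBounded n A u₀)
    {gt : ℝ → E → V} (hgtm : StronglyMeasurable (uncurry gt))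
    (hgt : ∀ n, ∃ G, ∀ s, IsCkBounded n G (gt s))
    {u : ℝ → E → V} {T : ℝ} (hT1 : T ≤ 1) (hsm : ∀ t, ContDiff ℝ ∞ (u t))
    (hcont : ∀ k, ContinuousOn (fun p : ℝ × E => iteratedFDeriv ℝ k (u p.1) p.2) (Icc 0 T ×ˢ univ))
    (hrep : ∀ t ∈ Ioc 0 T, u t = heatExtension u₀ t +
      fun x => ∫ s in Ioo 0 t, heatExtension (gt s) (t - s) x)
    (hgt_eq : ∀ t ∈ Ioc 0 T, gt t = fun y => f (y, u t y, fderiv ℝ (u t) y))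
    {t : ℝ} (ht : t ∈ Ioo 0 T) (x : E) :
    HasDerivAt (fun τ => u τ x) ((Δ (u t)) x + f (x, u t x, fderiv ℝ (u t) x)) t := by
  have h := hasDerivAt_iteratedFDeriv_slice hf hu₀ hgtm hgt hT1 hsm hcont hrep hgt_eq 0 ht x
  set e := (continuousMultilinearCurryFin0 ℝ E V).toContinuousLinearEquiv.toContinuousLinearMap with he
  have h' := e.hasFDerivAt.comp_hasDerivAt t h
  have hfun : (e ∘ fun τ => iteratedFDeriv ℝ 0 (u τ) x) = fun τ => u τ x := by
    funext τ
    simp [he, Function.comp_apply, iteratedFDeriv_zero_apply]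
  have hval : e (iteratedFDeriv ℝ 0 (fun y => (Δ (u t)) y + f (y, u t y, fderiv ℝ (u t) y)) x) =
      (Δ (u t)) x + f (x, u t x, fderiv ℝ (u t) x) := by
    simp [he, iteratedFDeriv_zero_apply]
  rw [hfun, hval] at h'
  exact h'

/-- **Joint smoothness up to the initial time.** Under the hypotheses of `contDiffOn_uncurry_Ioo`,
with moreover `u(0) = u₀`, all slices `u(t)`, `t ∈ (0, T]`, bounded in every `Cⁿ` uniformly in
`t`, and `V` finite-dimensional, `u` is `C^∞` on `[0, T) × E`: on every cylinder
`B(0, ρ) × (0, T)` the equation `∂ₜu = R(y, u, ∂u, ∂²u)` converts the spatial bounds into bounds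
on all space-time derivatives (`Calculus.bounded_iteratedFDeriv_of_evolution`, Topping 2006,
p. 47), so `u` extends smoothly to the closed cylinder
(`Calculus.exists_contDiffOn_closure_of_bounded_iteratedFDeriv`), the extension being `u(0) = u₀`
at `t = 0` by continuity. [cite: Topping2006, §5.3, proof of Thm. 5.3.1, p. 47] -/
theorem contDiffOn_uncurry_Ico [FiniteDimensional ℝ V]
    {f : E × V × (E →L[ℝ] V) → V} (hf : ContDiff ℝ ∞ f)
    {u₀ : E → V} (hu₀ : ∀ n, ∃ A, IsCkBounded n A u₀)
    {gt : ℝ → E → V} (hgtm : StronglyMeasurable (uncurry gt))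
    (hgt : ∀ n, ∃ G, ∀ s, IsCkBounded n G (gt s))
    {u : ℝ → E → V} {T : ℝ} (hT : 0 < T) (hT1 : T ≤ 1) (hsm : ∀ t, ContDiff ℝ ∞ (u t))
    (hslices : ∀ n, ∃ A, ∀ t ∈ Ioc 0 T, IsCkBounded n A (u t))
    (hcont : ∀ k, ContinuousOn (fun p : ℝ × E => iteratedFDeriv ℝ k (u p.1) p.2) (Icc 0 T ×ˢ univ))
    (hrep : ∀ t ∈ Ioc 0 T, u t = heatExtension u₀ t +
      fun x => ∫ s in Ioo 0 t, heatExtension (gt s) (t - s) x)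
    (hgt_eq : ∀ t ∈ Ioc 0 T, gt t = fun y => f (y, u t y, fderiv ℝ (u t) y)) :
    ContDiffOn ℝ ∞ (uncurry u) (Ico 0 T ×ˢ (univ : Set E)) := by
  -- the function in space–time order `w (y, t) = u t y`
  set w : E × ℝ → V := fun q => u q.2 q.1 with hw
  have hK3 := contDiffOn_uncurry_Ioo hf hu₀ hgtm hgt hT hT1 hsm hcont hrep hgt_eq
  have hwO : ContDiffOn ℝ ∞ w ((univ : Set E) ×ˢ Ioo 0 T) :=
    hK3.comp (contDiff_snd.prodMk contDiff_fst).contDiffOn fun q hq => ⟨hq.2, mem_univ _⟩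
  -- continuity of `w` on `E × [0, T]`
  have hc0 : ContinuousOn (fun p : ℝ × E => u p.1 p.2) (Icc 0 T ×ˢ univ) := by
    have h := (continuousMultilinearCurryFin0 ℝ E V).continuous.comp_continuousOn (hcont 0)
    refine h.congr fun p _ => ?_
    simp [Function.comp_apply, iteratedFDeriv_zero_apply]
  have hwc : ContinuousOn w ((univ : Set E) ×ˢ Icc 0 T) :=
    hc0.comp (continuous_snd.prodMk continuous_fst).continuousOn fun q hq => ⟨hq.2, mem_univ _⟩
  -- the equation for `w`
  have heqn : ∀ (y : E) (t : ℝ), t ∈ Ioo 0 T →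
      deriv (fun s => w (y, s)) t = (Δ (u t)) y + f (y, u t y, fderiv ℝ (u t) y) := fun y t ht =>
    (hasDerivAt_slice hf hu₀ hgtm hgt hT1 hsm hcont hrep hgt_eq ht y).deriv
  -- uniform low-order bounds on `(0, T]`
  obtain ⟨A, hA⟩ := hslices 2
  -- ### smoothness on every closed cylinder
  suffices hloc : ∀ ρ : ℝ, 0 < ρ → ContDiffOn ℝ ∞ w (ball (0 : E) ρ ×ˢ Ico 0 T) by
    have hw' : ContDiffOn ℝ ∞ w ((univ : Set E) ×ˢ Ico 0 T) := by
      refine contDiffOn_of_locally_contDiffOn fun q hq => ?_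
      refine ⟨ball (0 : E) (‖q.1‖ + 1) ×ˢ univ, isOpen_ball.prod isOpen_univ,
        ⟨mem_ball_zero_iff.2 (by linarith [norm_nonneg q.1]), mem_univ _⟩, ?_⟩
      exact (hloc (‖q.1‖ + 1) (by positivity)).mono fun r hr => ⟨hr.2.1, hr.1.2⟩
    exact hw'.comp (contDiff_snd.prodMk contDiff_fst).contDiffOn fun p hp => ⟨mem_univ _, hp.1⟩
  intro ρ hρ
  set Ω : Set (E × ℝ) := ball (0 : E) ρ ×ˢ Ioo 0 T with hΩ
  have hΩo : IsOpen Ω := isOpen_ball.prod isOpen_Ioo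
  have hΩc : Convex ℝ Ω := (convex_ball 0 ρ).prod (convex_Ioo 0 T)
  have hwΩ : ContDiffOn ℝ ∞ w Ω := hwO.mono (Set.prod_mono (subset_univ _) Subset.rfl)
  have hsb : SpatiallyBdd Ω w := by
    refine ⟨hwΩ, fun m => ?_⟩
    obtain ⟨Am, hAm⟩ := hslices m
    exact ⟨Am, fun q hq => (hAm q.2 ⟨hq.2.1, hq.2.2.le⟩).norm_le m le_rfl q.1⟩
  -- the compact jet range and the smooth right-hand side
  set K : Set (E × V × (E →L[ℝ] V) × (E →L[ℝ] E →L[ℝ] V)) :=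
    closedBall 0 ρ ×ˢ closedBall 0 A ×ˢ closedBall 0 A ×ˢ closedBall 0 A with hK
  have hKc : IsCompact K := (isCompact_closedBall 0 ρ).prod ((isCompact_closedBall 0 A).prod
    ((isCompact_closedBall 0 A).prod (isCompact_closedBall 0 A)))
  set R : E × V × (E →L[ℝ] V) × (E →L[ℝ] E →L[ℝ] V) → V := fun z =>
    (∑ i, z.2.2.2 (stdOrthonormalBasis ℝ E i) (stdOrthonormalBasis ℝ E i)) + f (z.1, z.2.1, z.2.2.1) with hR
  have hRc : ContDiff ℝ ∞ R := by
    refine (ContDiff.sum fun i _ => ?_).add (hf.comp (contDiff_fst.prodMk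
      ((contDiff_fst.comp contDiff_snd).prodMk (contDiff_fst.comp (contDiff_snd.comp contDiff_snd)))))
    have h3 : ContDiff ℝ ∞ fun z : E × V × (E →L[ℝ] V) × (E →L[ℝ] E →L[ℝ] V) => z.2.2.2 :=
      contDiff_snd.comp (contDiff_snd.comp contDiff_snd)
    exact ((ContinuousLinearMap.apply ℝ V (stdOrthonormalBasis ℝ E i)).contDiff.comp
      ((ContinuousLinearMap.apply ℝ (E →L[ℝ] V) (stdOrthonormalBasis ℝ E i)).contDiff.comp h3))
  have hrange : ∀ q ∈ Ω, (q.1, w q, dY w q, dY (dY w) q) ∈ K := by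
    rintro ⟨y, t⟩ ⟨hy, ht⟩
    have hb := hA t ⟨ht.1, ht.2.le⟩
    have hD2 : dY (dY w) (y, t) = fderiv ℝ (fderiv ℝ (u t)) y := rfl
    refine ⟨mem_closedBall_zero_iff.2 (mem_ball_zero_iff.1 hy).le, mem_closedBall_zero_iff.2 (hb.norm_apply_le y),
      mem_closedBall_zero_iff.2 (hb.norm_fderiv_le y), mem_closedBall_zero_iff.2 ?_⟩
    rw [hD2, norm_fderiv_fderiv_eq]
    exact hb.norm_le 2 le_rfl y
  have heq : ∀ q ∈ Ω, dT w q = R (q.1, w q, dY w q, dY (dY w) q) := by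
    rintro ⟨y, t⟩ ⟨hy, ht⟩
    have hD2 : dY (dY w) (y, t) = fderiv ℝ (fderiv ℝ (u t)) y := rfl
    change deriv (fun s => w (y, s)) t = _
    rw [heqn y t ht, hR]
    dsimp only
    rw [hD2, InnerProductSpace.laplacian_eq_iteratedFDeriv_orthonormalBasis (u t) (stdOrthonormalBasis ℝ E)]
    congr 1
    refine Finset.sum_congr rfl fun i _ => ?_
    rw [iteratedFDeriv_two_apply]
    rfl
  have hbd := fun n => bounded_iteratedFDeriv_of_evolution hΩo (ρ := ρ)
    (fun q hq => (mem_ball_zero_iff.1 hq.1).le) hsb isOpen_univ hKc (subset_univ _) hRc.contDiffOn hrange heq n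
  obtain ⟨W, hWc, hWeq, hWlim⟩ := exists_contDiffOn_closure_of_bounded_iteratedFDeriv hΩo hΩc hwΩ hbd
  have hcl : ball (0 : E) ρ ×ˢ Icc 0 T ⊆ closure Ω := by
    rw [hΩ, closure_prod_eq, closure_ball (0 : E) hρ.ne', closure_Ioo hT.ne]
    exact Set.prod_mono ball_subset_closedBall Subset.rfl
  have hWw : ∀ q ∈ ball (0 : E) ρ ×ˢ Ico (0 : ℝ) T, W q = w q := by
    rintro ⟨y, t⟩ ⟨hy, ht⟩
    rcases ht.1.eq_or_lt with h0 | ht0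
    · subst h0
      have hmem : ((y, (0 : ℝ)) : E × ℝ) ∈ closure Ω := hcl ⟨hy, le_rfl, hT.le⟩
      have h1 : Tendsto w (𝓝[Ω] (y, 0)) (𝓝 (W (y, 0))) := hWlim (y, 0) hmem
      have h2 : Tendsto w (𝓝[Ω] (y, 0)) (𝓝 (w (y, 0))) :=
        ((hwc (y, 0) ⟨mem_univ _, le_rfl, hT.le⟩).mono
          (Set.prod_mono (subset_univ _) Ioo_subset_Icc_self)).tendsto
      haveI : (𝓝[Ω] ((y, (0 : ℝ)) : E × ℝ)).NeBot := mem_closure_iff_nhdsWithin_neBot.1 hmem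
      exact tendsto_nhds_unique h1 h2
    · exact hWeq ⟨hy, ht0, ht.2⟩
  exact (hWc.mono ((Set.prod_mono Subset.rfl Ico_subset_Icc_self).trans hcl)).congr fun q hq => (hWw q hq).symm

end Classical

end SemilinearHeat

end Literature.Analysis.PDE
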